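/-
Copyright (c) 2026 the pub-hodgecm-mathlib formalisation cell (harness21).  Prover seat hodgecm-mathlib-K2Liu-p10 (g0), Track B «K2-LIT»,
#184♮ = hLiu418 = `stmt-HodgeConjecture-24832`; LEAD F0P6-plan (g12) DEAL 2026-09-04T06:27:59Z «Hol-2» (SIGS-RoadI-v3 §Hol.3 «holomorphic Fourier rigidity»),
file Hol-2a — the dictionary-free complex analysis: a holomorphic function of several variables invariant under all REAL translations is constant;
an exponential beats every polynomial along a ray; a constant automorphy cocycle with a non-trivial factor forces the constant to vanish.
-/
import Mathlib.Analysis.Calculus.MeanValue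
import Mathlib.Analysis.SpecialFunctions.Pow.Asymptotics
import Mathlib.Analysis.Complex.Basic
import HarnessLib

/-!
# Crux `HLiu418`, road `K2_Liu` (Road I v3, §Hol.3), file Hol-2a: three dictionary-free lemmas behind holomorphic Fourier rigidity

Cell `hodgecm-mathlib`, crux item hLiu418 = `stmt-HodgeConjecture-24832`; squad K2, LEAD F0P6-plan (g12) (deal «Hol-2» 2026-09-04T06:27:59Z), box K2E5-r01 (g6),
consumer: Hol-2b `K2LiuHolFourierRigidity` (assembly on Hol-1's tube dictionary, K2Liu-p11).  THEOREMS ONLY (Mathlib only; no `def`, no instance, no notation,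
no named-fact hypothesis, no `sorry`); lane `--supports stmt-HodgeConjecture-24832 --as helper` (count-neutral helper).

* §1 (H) **`apply_eq_apply_of_differentiableOn_of_forall_add_real`** — `U ⊆ ℂ^ι` open and convex, `φ` ℂ-differentiable on `U` with `φ(z + b) = φ(z)` for all REAL
  vectors `b` (whenever `z, z + b ∈ U`) ⇒ `φ` is constant on `U`.  (Each real direction `b` has directional derivative `0`; the ℂ-linear derivative then kills
  `b` AND `i b`, i.e. everything; a function with zero derivative on a convex set is constant — Mathlib `Convex.is_const_of_fderivWithin_eq_zero`.)
  USE (Hol.3 (a)): with ★ Φ1 `fourierCoeffDelta_unipDelta_mul` the `β`-th adelic Fourier coefficient of a holomorphic-type `F` is `ψ_{β,∞}`-equivariant under ALL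
  archimedean translations, so `Z ↦ e^{−2πi tr(βZ)} f_{F_β}(Z)` is real-translation invariant and holomorphic on the tube, hence constant `= a_β`.
* §2 (K) **`eq_zero_of_norm_mul_exp_le_mul_pow`** — `‖a‖·e^{κt} ≤ C·t^N` for all `t ≥ 1` with `κ > 0` forces `a = 0` (Koecher sign, Hol.3 (b): moderate growth along
  the ray `Z = itY` against `|e^{2πi tr(β·itY)}| = e^{−2πt tr(βY)}`).
* §3 (C) **`eq_zero_of_forall_eq_const_of_cocycle`** — if `f = c₀` on `T`, `f(γ Z) = J(Z)·f(Z)` on `T` for a self-map `γ` of `T`, and `J(Z₀) ≠ 1` somewhere on `T`,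
  then `c₀ = 0` (Hol.3 (c): `γ = w_Δ`, `J = j(w_Δ, ·)^k = det(·)^{±k}`, non-constant for `k ≠ 0`).
[Shimura1997, §5] [PlatonovRapinchuk1994, §7.1] — provenance only; the lemmas are folklore complex analysis.
HONEST LABEL.  Count-neutral helper; `HC_CM` is proved only modulo the 7 printed citations (2 remaining named inputs: hLiu418 = `stmt-HodgeConjecture-24832`,
h413 = `stmt-HodgeConjecture-24833`) until rung 0 closes.
-/

set_option autoImplicit false
set_option linter.dupNamespace false -- the mandated namespace repeats `HodgeConjecture.HodgeConjecture`

noncomputable section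

namespace Summit.HodgeConjecture.HodgeConjecture.Cruxes.HLiu418.K2LiuHolTranslationInvariantConst

open Topology Filter Set Function

/-! ## §1 (H) holomorphic and real-translation invariant ⇒ constant -/

section TranslationInvariant

variable {ι : Type*} [Fintype ι]

/-- the derivative of a ℂ-differentiable real-translation-invariant `φ` kills every REAL direction. [folklore] -/
theorem fderiv_apply_ofReal_eq_zero {U : Set (ι → ℂ)} (hU : IsOpen U) {φ : (ι → ℂ) → ℂ} (hφ : DifferentiableOn ℂ φ U)
    (hinv : ∀ z ∈ U, ∀ b : ι → ℝ, z + (fun i => (b i : ℂ)) ∈ U → φ (z + fun i => (b i : ℂ)) = φ z)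
    {z : ι → ℂ} (hz : z ∈ U) (b : ι → ℝ) :
    fderiv ℂ φ z (fun i => (b i : ℂ)) = 0 := by
  -- the real path `t ↦ z + t • b` and the composite `g = φ ∘ path`
  have hpath : HasDerivAt (fun t : ℝ => z + (t : ℂ) • (fun i => (b i : ℂ))) ((1 : ℂ) • fun i => (b i : ℂ)) 0 :=
    (Complex.ofRealCLM.hasDerivAt.smul_const (fun i => (b i : ℂ))).const_add z
  rw [one_smul] at hpath
  have hφz : HasFDerivAt φ (fderiv ℂ φ z) z := (hφ.differentiableAt (hU.mem_nhds hz)).hasFDerivAt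
  have hcomp : HasDerivAt (φ ∘ fun t : ℝ => z + (t : ℂ) • (fun i => (b i : ℂ))) ((fderiv ℂ φ z).restrictScalars ℝ (fun i => (b i : ℂ))) 0 :=
    (hφz.restrictScalars ℝ).comp_hasDerivAt_of_eq (0 : ℝ) hpath (by simp)
  -- `g` is constant near `0`: the path stays in `U` and `φ` is invariant under the real translation `t • b`
  have hnear : ∀ᶠ t : ℝ in 𝓝 0, z + (t : ℂ) • (fun i => (b i : ℂ)) ∈ U := by
    have hc : Continuous fun t : ℝ => z + (t : ℂ) • (fun i => (b i : ℂ)) :=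
      continuous_const.add ((Complex.continuous_ofReal.smul continuous_const))
    have h0 : (fun t : ℝ => z + (t : ℂ) • (fun i => (b i : ℂ))) 0 ∈ U := by simpa using hz
    exact hc.continuousAt.preimage_mem_nhds (hU.mem_nhds h0)
  have hconst : (φ ∘ fun t : ℝ => z + (t : ℂ) • (fun i => (b i : ℂ))) =ᶠ[𝓝 0] fun _ => φ z := by
    filter_upwards [hnear] with t ht
    have hb : (t : ℂ) • (fun i => (b i : ℂ)) = fun i => ((t • b) i : ℂ) := by
      funext i; simp [Pi.smul_apply, smul_eq_mul, Complex.ofReal_mul]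
    show φ (z + (t : ℂ) • (fun i => (b i : ℂ))) = φ z
    rw [hb] at ht ⊢
    exact hinv z hz (t • b) ht
  have hzero : HasDerivAt (φ ∘ fun t : ℝ => z + (t : ℂ) • (fun i => (b i : ℂ))) 0 0 :=
    (hasDerivAt_const (0 : ℝ) (φ z)).congr_of_eventuallyEq hconst
  have := hcomp.unique hzero
  simpa using this

/-- the derivative of a ℂ-differentiable real-translation-invariant `φ` VANISHES (real vectors span `ℂ^ι` over `ℂ`). [folklore] -/
theorem fderiv_eq_zero {U : Set (ι → ℂ)} (hU : IsOpen U) {φ : (ι → ℂ) → ℂ} (hφ : DifferentiableOn ℂ φ U)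
    (hinv : ∀ z ∈ U, ∀ b : ι → ℝ, z + (fun i => (b i : ℂ)) ∈ U → φ (z + fun i => (b i : ℂ)) = φ z)
    {z : ι → ℂ} (hz : z ∈ U) : fderiv ℂ φ z = 0 := by
  refine ContinuousLinearMap.ext fun v => ?_
  have hv : v = (fun i => ((v i).re : ℂ)) + Complex.I • (fun i => ((v i).im : ℂ)) := by
    funext i; simp [Pi.add_apply, Pi.smul_apply, smul_eq_mul, mul_comm Complex.I, Complex.re_add_im]
  rw [hv, map_add, map_smul, fderiv_apply_ofReal_eq_zero hU hφ hinv hz, fderiv_apply_ofReal_eq_zero hU hφ hinv hz, smul_zero, add_zero]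
  rfl

/-- **(H) A HOLOMORPHIC FUNCTION OF SEVERAL VARIABLES INVARIANT UNDER ALL REAL TRANSLATIONS IS CONSTANT** on an open convex set.
[cite: Shimura1997, §5] -/
theorem apply_eq_apply_of_differentiableOn_of_forall_add_real {U : Set (ι → ℂ)} (hU : IsOpen U) (hUc : Convex ℝ U) {φ : (ι → ℂ) → ℂ}
    (hφ : DifferentiableOn ℂ φ U) (hinv : ∀ z ∈ U, ∀ b : ι → ℝ, z + (fun i => (b i : ℂ)) ∈ U → φ (z + fun i => (b i : ℂ)) = φ z)
    {x y : ι → ℂ} (hx : x ∈ U) (hy : y ∈ U) : φ x = φ y :=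
  hUc.is_const_of_fderivWithin_eq_zero hφ (fun z hz => by rw [fderivWithin_of_isOpen hU hz]; exact fderiv_eq_zero hU hφ hinv hz) hx hy

/-- (H), `∃`-form: `∃ c, φ = c` on `U`. [cite: Shimura1997, §5] -/
theorem exists_eq_const_of_differentiableOn_of_forall_add_real {U : Set (ι → ℂ)} (hU : IsOpen U) (hUc : Convex ℝ U) {φ : (ι → ℂ) → ℂ}
    (hφ : DifferentiableOn ℂ φ U) (hinv : ∀ z ∈ U, ∀ b : ι → ℝ, z + (fun i => (b i : ℂ)) ∈ U → φ (z + fun i => (b i : ℂ)) = φ z) :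
    ∃ c : ℂ, ∀ z ∈ U, φ z = c := by
  rcases U.eq_empty_or_nonempty with hUe | ⟨x₀, hx₀⟩
  · exact ⟨0, fun z hz => by simp [hUe] at hz⟩
  · exact ⟨φ x₀, fun z hz => apply_eq_apply_of_differentiableOn_of_forall_add_real hU hUc hφ hinv hz hx₀⟩

end TranslationInvariant

/-! ## §2 (K) an exponential beats every polynomial along a ray -/

/-- **(K) `‖a‖·e^{κ t} ≤ C·t^N` for all `t ≥ 1` (`κ > 0`) forces `a = 0`.** [folklore] -/
theorem eq_zero_of_norm_mul_exp_le_mul_pow {a : ℂ} {κ C : ℝ} {N : ℕ} (hκ : 0 < κ)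
    (h : ∀ t : ℝ, 1 ≤ t → ‖a‖ * Real.exp (κ * t) ≤ C * t ^ N) : a = 0 := by
  by_contra ha
  have hapos : 0 < ‖a‖ := norm_pos_iff.2 ha
  -- `e^{κt}/t^N ≤ C/‖a‖` on `[1, ∞)`, contradicting `e^{κt}/t^N → ∞`
  have hbound : ∀ t : ℝ, 1 ≤ t → Real.exp (κ * t) / t ^ (N : ℝ) ≤ C / ‖a‖ := by
    intro t ht
    have htpos : 0 < t ^ (N : ℝ) := Real.rpow_pos_of_pos (lt_of_lt_of_le one_pos ht) _
    rw [Real.rpow_natCast, div_le_div_iff₀ (by exact_mod_cast htpos) hapos]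
    calc Real.exp (κ * t) * ‖a‖ = ‖a‖ * Real.exp (κ * t) := mul_comm _ _
      _ ≤ C * t ^ N := h t ht
  have htend := tendsto_exp_mul_div_rpow_atTop (N : ℝ) κ hκ
  have hev : ∀ᶠ t : ℝ in atTop, C / ‖a‖ + 1 ≤ Real.exp (κ * t) / t ^ (N : ℝ) := htend.eventually (eventually_ge_atTop _)
  obtain ⟨t, ht1, ht⟩ := (hev.and (eventually_ge_atTop 1)).exists
  linarith [hbound t ht]

/-! ## §3 (C) a constant automorphy cocycle with a non-trivial factor vanishes -/

/-- **(C) if `f = c₀` on `T`, `f(γ Z) = J(Z)·f(Z)` on `T` with `γ(T) ⊆ T`, and `J(Z₀) ≠ 1` for some `Z₀ ∈ T`, then `c₀ = 0`.** [folklore] -/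
theorem eq_zero_of_forall_eq_const_of_cocycle {X : Type*} {T : Set X} {f : X → ℂ} {c₀ : ℂ} (hf : ∀ Z ∈ T, f Z = c₀)
    {γ : X → X} (hγ : MapsTo γ T T) {J : X → ℂ} (hcov : ∀ Z ∈ T, f (γ Z) = J Z * f Z) (hJ : ∃ Z ∈ T, J Z ≠ 1) : c₀ = 0 := by
  obtain ⟨Z, hZ, hJZ⟩ := hJ
  have h := hcov Z hZ
  rw [hf _ (hγ hZ), hf Z hZ] at h
  -- `c₀ = J Z * c₀` with `J Z ≠ 1`
  by_contra hc
  exact hJZ (mul_right_cancel₀ hc (by rw [one_mul]; exact h.symm))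

end Summit.HodgeConjecture.HodgeConjecture.Cruxes.HLiu418.K2LiuHolTranslationInvariantConst
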